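import Summits.BirchSwinnertonDyer.Rank1Residual.P2.CountsAtTwoZhai16
import Literature.NumberTheory.EllipticCurves.Zhai2016.NonvanishingQuadraticTwistsErratum
import HarnessLib

/-!
# Sub-lane «bsd-p2»: ERRATUM to the P2 consumers of Zhai 2016 Thms 1.1 / 1.2 / 1.3 / 1.5 — the COUNT forms
# re-derived from the CORRECTED named facts (arXiv v2, 2017: odd Manin constant; `E[2](ℚ) ≠ 0` in 1.3/1.5)

HONEST FRAMING (sub-lane «bsd-p2», run/shared/lean/b2b/bsd-rank1-residual/p2/, verbatim in every
file): the target of record is the FULL Birch–Swinnerton-Dyer formula for EVERY analytic-rank `≤ 1`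
`E/ℚ` at ALL primes INCLUDING `2`; the odd-prime class ledger is referee A's; the `2`-part is OPEN
(cells O1 = X5 ∖ CM and O12 = the CM corner) and under census by «bsd-p2». Census / instrument
output at `2` = EVIDENCE / conjecture items with held-out validation, NEVER a Literature fact;
certificates close PAIRS (one isogeny class, `p = 2`), never classes. This file asserts NO
arithmetic fact. ERRATUM NOTE (p2-lead WAKE-T-156 / LEAD-OKS BATCH 61 (vii); lit GEN 98 flags
`Zhai16-v2-odd-Manin-standing-assumption`, `Zhai16-Thm1.3/1.5-E[2](ℚ)≠0-not-transcribed`): the named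
facts consumed by §2–§3 of `P2/CountsAtTwoZhai16.lean` (`Zhai2016.thm11_…`, `thm12_…`, `thm13_…`,
`thm15_…`, p313726) transcribe arXiv v1 of Zhai 2016 and omit the author's post-publication STANDING
ASSUMPTION «the Manin constant `ν_E` is odd» (arXiv v2, 2017; all theorems) and the restriction
`E[2](ℚ) ≠ 0` of Thms 1.3/1.5; AS TYPED they are stronger than print whenever the conductor is even, so
those consumers are MIS-STATED-PENDING for p2 (they remain valid KERNEL theorems, conditional on
hypotheses too strong to be discharged from print for even conductor; they asserted and booked nothing).
THIS FILE re-derives the same COUNT forms from the CORRECTED facts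
`Zhai2016.thm11_ordTwo_LAlg_twist_eq_zero'`, `thm12_…'`, `thm13_…'`, `thm15_…'`
(`Zhai2016/NonvanishingQuadraticTwistsErratum.lean`) with the new binders PASSED THROUGH —
`hν : ¬ 2 ∣ Dt.c` (odd Manin constant) on all four, `h2 : #E(ℚ)[2] ≠ 1` on 1.3/1.5 — proofs otherwise
verbatim (§1 bookkeeping of the v1 file reused by import; the v1 theorems are kept, untouched).
`cell_twist_of_zhai11_12` (grid placement) consumes NO Zhai fact and needs no twin; §4 (Thm 1.4,
Neumann–Setzer, prime conductor `u² + 64` — odd, Abbes–Ullmo) is UNAFFECTED. Kernel shapes unchanged: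
a count concerns ONE pair; it never closes a cell. Nothing booked; no mark moved.
Unit `b2b-bsdres-p2-typer` GEN 21; NEW file (sibling: the v1 file is at 398 lines).

References: S. Zhai, Asian J. Math. 20 (2016) 475–502; arXiv:1409.0231v2 (2017) Thms 1.1/1.3/1.5/1.7 and
the standing assumption [Zhai2016]; Miller 2011 Def 1.1 [Miller2011LMS]; CLTZ 2015 §1 (1.3)
[CoatesLiTianZhai2015]; HOME/p2/typer/lean/errata/ZHAI2016-V2-BINDERS.md.
-/

noncomputable section

open scoped Classical MatrixGroups ModularForm

open CongruenceSubgroup NumberField WeierstrassCurve Literature.NumberTheory.EllipticCurves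
  Literature.NumberTheory.EllipticCurves.ModularForms
  Literature.NumberTheory.EllipticCurves.Rank1Residual
  Literature.NumberTheory.EllipticCurves.Rank1Residual.Typed
  Literature.NumberTheory.EllipticCurves.CoatesLiTianZhai2015
  Literature.NumberTheory.EllipticCurves.Zhai2016

set_option autoImplicit false

namespace Summit.BirchSwinnertonDyer.Rank1Residual.P2

/-! ## §2′ Thm 1.1 / Thm 1.2 corrected: odd Manin constant -/

section Irreducible

variable {W : WeierstrassCurve ℚ} [W.IsElliptic] [W.IsGloballyMinimal] [NeZero (W.conductorNorm ℤ)]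

/-- **COUNT FORM (Zhai 2016 Thm 1.1 at `2`, CORRECTED binders).** As `bsdp_two_twist_iff_of_zhai11`
with the corrected fact `thm11_ordTwo_LAlg_twist_eq_zero'` and the extra binder `hν : ¬ 2 ∣ Dt.c` (odd
Manin constant, arXiv v2 standing assumption) passed through: `r_an(E^{(M)}) = 0` and
`BSD(E^{(M)},2) ⟺ ord₂ #Ш(E^{(M)}) + ord₂ ∏ c_ℓ(E^{(M)}) = 0`. No GZK, no base certificate; per pair.
[cite: Zhai2016, Thm. 1.1 (arXiv:1409.0231v2 TeX ll. 273–279; standing assumption ll. 255–263)] [cite: Miller2011LMS, Def. 1.1] -/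
theorem bsdp_two_twist_iff_of_zhai11' (h11 : thm11_ordTwo_LAlg_twist_eq_zero')
    (hmod : hasEntireLFunction_rat) (Dt : ModularParametrizationData W (W.conductorNorm ℤ))
    (hopt : Zhai2021.IsOptimalDatum W Dt) (hν : ¬ (2 : ℤ) ∣ Dt.c) (hΔ : W.Δ < 0)
    (h1 : Nat.card {P : W.toAffine.Point // (2 : ℕ) • P = 0} = 1)
    (hL : ∃ x : ℚ, IsLAlg W x ∧ x ≠ 0 ∧ padicValRat 2 x = 0)
    (F : Type) [Field F] [NumberField F] (hF : IsTwoDivisionField W F)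
    (M : ℤ) (hsq : Squarefree M) (hM4 : M % 4 = 1) (hgcd : Int.gcd M (W.conductorNorm ℤ) = 1)
    (hne : M.natAbs.primeFactors.Nonempty) (hin : ∀ q ∈ M.natAbs.primeFactors, q ≠ 2 ∧ IsInertIn F q)
    {WM : WeierstrassCurve ℚ} [WM.IsElliptic] [WM.IsGloballyMinimal]
    (hWM : ∃ C : VariableChange ℚ, C • W.quadraticTwist (M : ℚ) = WM) :
    WM.analyticRank = 0 ∧
      (BSDp WM 2 ↔ padicValNat 2 (Nat.card WM.sha) + padicValNat 2 WM.tamagawaProduct = 0) := by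
  obtain ⟨⟨x, hx, hx0, hv⟩, -, hfinPt, hfinSha⟩ :=
    h11 W Dt hopt hν hΔ h1 hL F hF M hsq hM4 hgcd hne hin WM hWM
  haveI := hfinSha
  have hM0 : (M : ℚ) ≠ 0 := by exact_mod_cast hsq.ne_zero
  have hΔM : WM.Δ < 0 := by
    have hnot : ¬ 0 < WM.Δ := fun h' => absurd ((Δ_pos_iff_of_twist W hM0 hWM).mpr h') (not_lt.mpr hΔ.le)
    exact lt_of_le_of_ne (not_lt.mp hnot) WM.isUnit_Δ.ne_zero
  have hc : (WM.baseChange ℝ).numRealComponents = 1 := numRealComponents_eq_one_of_Δ_neg hΔM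
  have hirr : Irr WM 2 := (irr_two_iff_of_twist W hM0 hWM).mp (irr_two_of_card_twoTorsion_eq_one W h1)
  have htor : padicValNat 2 WM.torsionOrder = 0 := padicValNat_torsionOrder_eq_zero_of_irreducible WM 2 hirr
  obtain ⟨hr, iff⟩ := bsdp_two_iff_of_isLAlg hmod WM hx hx0 hfinPt
  have h1' : padicValNat 2 1 = 0 := by simp
  rw [hv, hc, htor, h1'] at iff
  refine ⟨hr, iff.trans ?_⟩
  simp only [Nat.cast_zero, sub_zero, mul_zero]
  omega

/-- **COUNT FORM (Zhai 2016 Thm 1.2 at `2`, CORRECTED binders).** As `bsdp_two_twist_iff_of_zhai12`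
with the corrected fact `thm12_ordTwo_LAlg_twist_eq_one'` and `hν : ¬ 2 ∣ Dt.c` passed through:
`r_an(E^{(M)}) = 0` and `BSD(E^{(M)},2) ⟺ ord₂ #Ш(E^{(M)}) + ord₂ ∏ c_ℓ(E^{(M)}) = 0`.
[cite: Zhai2016, Thm. 1.2 (arXiv:1409.0231v2 Thm. 1.3, TeX ll. 315–321)] [cite: Miller2011LMS, Def. 1.1] -/
theorem bsdp_two_twist_iff_of_zhai12' (h12 : thm12_ordTwo_LAlg_twist_eq_one')
    (hmod : hasEntireLFunction_rat) (Dt : ModularParametrizationData W (W.conductorNorm ℤ))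
    (hopt : Zhai2021.IsOptimalDatum W Dt) (hν : ¬ (2 : ℤ) ∣ Dt.c) (hΔ : 0 < W.Δ)
    (h1 : Nat.card {P : W.toAffine.Point // (2 : ℕ) • P = 0} = 1)
    (hL : ∃ x : ℚ, IsLAlg W x ∧ x ≠ 0 ∧ padicValRat 2 x = 1)
    (F : Type) [Field F] [NumberField F] (hF : IsTwoDivisionField W F)
    (M : ℤ) (hMpos : 0 < M) (hsq : Squarefree M) (hM4 : M % 4 = 1)
    (hgcd : Int.gcd M (W.conductorNorm ℤ) = 1)
    (hne : M.natAbs.primeFactors.Nonempty) (hin : ∀ q ∈ M.natAbs.primeFactors, q ≠ 2 ∧ IsInertIn F q)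
    {WM : WeierstrassCurve ℚ} [WM.IsElliptic] [WM.IsGloballyMinimal]
    (hWM : ∃ C : VariableChange ℚ, C • W.quadraticTwist (M : ℚ) = WM) :
    WM.analyticRank = 0 ∧
      (BSDp WM 2 ↔ padicValNat 2 (Nat.card WM.sha) + padicValNat 2 WM.tamagawaProduct = 0) := by
  obtain ⟨⟨x, hx, hx0, hv⟩, -, hfinPt, hfinSha⟩ :=
    h12 W Dt hopt hν hΔ h1 hL F hF M hMpos hsq hM4 hgcd hne hin WM hWM
  haveI := hfinSha
  have hM0 : (M : ℚ) ≠ 0 := by exact_mod_cast hsq.ne_zero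
  have hΔM : 0 < WM.Δ := (Δ_pos_iff_of_twist W hM0 hWM).mp hΔ
  have hc : (WM.baseChange ℝ).numRealComponents = 2 := numRealComponents_eq_two_of_Δ_pos hΔM
  have hirr : Irr WM 2 := (irr_two_iff_of_twist W hM0 hWM).mp (irr_two_of_card_twoTorsion_eq_one W h1)
  have htor : padicValNat 2 WM.torsionOrder = 0 := padicValNat_torsionOrder_eq_zero_of_irreducible WM 2 hirr
  obtain ⟨hr, iff⟩ := bsdp_two_iff_of_isLAlg hmod WM hx hx0 hfinPt
  rw [hv, hc, htor] at iff
  refine ⟨hr, iff.trans ?_⟩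
  have h2 : padicValNat 2 2 = 1 := by simp
  simp only [h2, Nat.cast_one, Nat.cast_zero, sub_self, mul_zero, sub_zero]
  omega

end Irreducible

/-! ## §3′ Thm 1.3 / Thm 1.5 corrected: odd Manin constant and `E[2](ℚ) ≠ 0` -/

section OnePrime

variable {W : WeierstrassCurve ℚ} [W.IsElliptic] [W.IsGloballyMinimal] [NeZero (W.conductorNorm ℤ)]

/-- **COUNT FORM (Zhai 2016 Thm 1.3 at `2`, CORRECTED binders).** As `bsdp_two_twist_iff_of_zhai13`
with the corrected fact `thm13_ordTwo_LAlg_primeTwist_eq_zero'` and the two new binders passed through: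
`hν : ¬ 2 ∣ Dt.c` (odd Manin constant) and `h2 : #E(ℚ)[2] ≠ 1` (print's `E[2](ℚ) ≠ 0`):
`r_an(E^{(M)}) = 0` and `BSD(E^{(M)},2) ⟺ ord₂ #Ш + ord₂ ∏ c_ℓ = 2·ord₂ #E^{(M)}(ℚ)_tor`.
[cite: Zhai2016, Thm. 1.3 (arXiv:1409.0231v2 Thm. 1.5, TeX ll. 350–356)] [cite: Miller2011LMS, Def. 1.1] -/
theorem bsdp_two_twist_iff_of_zhai13' (h13 : thm13_ordTwo_LAlg_primeTwist_eq_zero')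
    (hmod : hasEntireLFunction_rat) (Dt : ModularParametrizationData W (W.conductorNorm ℤ))
    (hopt : Zhai2021.IsOptimalDatum W Dt) (hν : ¬ (2 : ℤ) ∣ Dt.c) (hΔ : W.Δ < 0)
    (h2 : Nat.card {P : W.toAffine.Point // (2 : ℕ) • P = 0} ≠ 1) (hLW : W.entireLFunction 1 ≠ 0)
    (x₀ : ℚ) (hx₀ : IsLAlg W x₀) (q : ℕ) (hq : q.Prime) (hq2 : q ≠ 2)
    (hqC : ¬ q ∣ W.conductorNorm ℤ)
    (hNq : (padicValNat 2 (W.reductionPointCount q) : ℤ) = -padicValRat 2 x₀)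
    (hNq0 : padicValNat 2 (W.reductionPointCount q) ≠ 0)
    (M : ℤ) (hM : M = q ∨ M = -q) (hM4 : M % 4 = 1)
    {WM : WeierstrassCurve ℚ} [WM.IsElliptic] [WM.IsGloballyMinimal]
    (hWM : ∃ C : VariableChange ℚ, C • W.quadraticTwist (M : ℚ) = WM) :
    WM.analyticRank = 0 ∧
      (BSDp WM 2 ↔ padicValNat 2 (Nat.card WM.sha) + padicValNat 2 WM.tamagawaProduct =
        2 * padicValNat 2 WM.torsionOrder) := by
  obtain ⟨⟨x, hx, hx0, hv⟩, -, hfinPt, hfinSha⟩ :=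
    h13 W Dt hopt hν hΔ h2 hLW x₀ hx₀ q hq hq2 hqC hNq hNq0 M hM hM4 WM hWM
  haveI := hfinSha
  have hM0 : (M : ℚ) ≠ 0 := by
    have : (q : ℤ) ≠ 0 := by exact_mod_cast hq.ne_zero
    rcases hM with rfl | rfl <;> push_cast <;> [exact_mod_cast this; exact neg_ne_zero.mpr (by exact_mod_cast this)]
  have hΔM : WM.Δ < 0 := by
    have hnot : ¬ 0 < WM.Δ := fun h' => absurd ((Δ_pos_iff_of_twist W hM0 hWM).mpr h') (not_lt.mpr hΔ.le)
    exact lt_of_le_of_ne (not_lt.mp hnot) WM.isUnit_Δ.ne_zero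
  have hc : (WM.baseChange ℝ).numRealComponents = 1 := numRealComponents_eq_one_of_Δ_neg hΔM
  obtain ⟨hr, iff⟩ := bsdp_two_iff_of_isLAlg hmod WM hx hx0 hfinPt
  have h1 : padicValNat 2 1 = 0 := by simp
  rw [hv, hc, h1] at iff
  refine ⟨hr, iff.trans ?_⟩
  simp only [Nat.cast_zero, sub_zero]
  omega

/-- **COUNT FORM (Zhai 2016 Thm 1.5 at `2`, CORRECTED binders).** As `bsdp_two_twist_iff_of_zhai15`
with the corrected fact `thm15_ordTwo_LAlg_primeTwist_eq_one'` and the two new binders passed through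
(`hν : ¬ 2 ∣ Dt.c`, `h2 : #E(ℚ)[2] ≠ 1`): `r_an(E^{(q)}) = 0` and
`BSD(E^{(q)},2) ⟺ ord₂ #Ш + ord₂ ∏ c_ℓ = 2·ord₂ #E^{(q)}(ℚ)_tor`.
[cite: Zhai2016, Thm. 1.5 (arXiv:1409.0231v2 Thm. 1.7, TeX ll. 393–399)] [cite: Miller2011LMS, Def. 1.1] -/
theorem bsdp_two_twist_iff_of_zhai15' (h15 : thm15_ordTwo_LAlg_primeTwist_eq_one')
    (hmod : hasEntireLFunction_rat) (Dt : ModularParametrizationData W (W.conductorNorm ℤ))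
    (hopt : Zhai2021.IsOptimalDatum W Dt) (hν : ¬ (2 : ℤ) ∣ Dt.c) (hΔ : 0 < W.Δ)
    (h2 : Nat.card {P : W.toAffine.Point // (2 : ℕ) • P = 0} ≠ 1) (hLW : W.entireLFunction 1 ≠ 0)
    (x₀ : ℚ) (hx₀ : IsLAlg W x₀) (q : ℕ) (hq : q.Prime) (hq4 : q % 4 = 1)
    (hqC : ¬ q ∣ W.conductorNorm ℤ)
    (hNq : (padicValNat 2 (W.reductionPointCount q) : ℤ) = 1 - padicValRat 2 x₀)
    (hNq0 : padicValNat 2 (W.reductionPointCount q) ≠ 0)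
    {WM : WeierstrassCurve ℚ} [WM.IsElliptic] [WM.IsGloballyMinimal]
    (hWM : ∃ C : VariableChange ℚ, C • W.quadraticTwist (q : ℚ) = WM) :
    WM.analyticRank = 0 ∧
      (BSDp WM 2 ↔ padicValNat 2 (Nat.card WM.sha) + padicValNat 2 WM.tamagawaProduct =
        2 * padicValNat 2 WM.torsionOrder) := by
  obtain ⟨⟨x, hx, hx0, hv⟩, -, hfinPt, hfinSha⟩ :=
    h15 W Dt hopt hν hΔ h2 hLW x₀ hx₀ q hq hq4 hqC hNq hNq0 WM hWM
  haveI := hfinSha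
  have hq0 : (q : ℚ) ≠ 0 := by exact_mod_cast hq.ne_zero
  have hΔM : 0 < WM.Δ := (Δ_pos_iff_of_twist W hq0 hWM).mp hΔ
  have hc : (WM.baseChange ℝ).numRealComponents = 2 := numRealComponents_eq_two_of_Δ_pos hΔM
  obtain ⟨hr, iff⟩ := bsdp_two_iff_of_isLAlg hmod WM hx hx0 hfinPt
  rw [hv, hc] at iff
  refine ⟨hr, iff.trans ?_⟩
  have h2' : padicValNat 2 2 = 1 := by simp
  simp only [h2', Nat.cast_one, sub_self]
  omega

omit [W.IsGloballyMinimal] [NeZero (W.conductorNorm ℤ)] in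
/-- **Grid placement for the corrected Thm 1.3 / 1.5 twists**: with print's `E[2](ℚ) ≠ 0` on the base the
twist has image bit `borel` (a rational `2`-torsion point; twist invariance of `Red` at `2`) and rank bit
`r0` — cells `r0.·.borel.·` (the v1 file typed the `≠ borel` placement of Thms 1.1/1.2 only).
[cite: Zhai2016, Thms. 1.3/1.5 (arXiv:1409.0231v2 Thms. 1.5/1.7: "satisfies E[2](ℚ) ≠ 0")] -/
theorem cell_twist_of_zhai13_15' (hmod : hasEntireLFunction_rat)
    (h2 : Nat.card {P : W.toAffine.Point // (2 : ℕ) • P = 0} ≠ 1) {M : ℤ} (hM : M ≠ 0)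
    {WM : WeierstrassCurve ℚ} [WM.IsElliptic] [WM.IsGloballyMinimal]
    (hWM : ∃ C : VariableChange ℚ, C • W.quadraticTwist (M : ℚ) = WM)
    (hLne : WM.entireLFunction 1 ≠ 0) :
    (cellAtTwoOf WM).r1 = false ∧ (cellAtTwoOf WM).img = .borel := by
  have hr : WM.analyticRank = 0 := (WM.analyticRank_eq_zero_iff_holds (hmod WM)).2 hLne
  refine ⟨?_, ?_⟩
  · show decide (WM.analyticRank = 1) = false
    rw [decide_eq_false_iff_not]; omega
  · rw [cellAtTwoOf_img, imgAtTwoOf_eq_borel_iff]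
    refine (red_two_iff_of_twist W (by exact_mod_cast hM) hWM).mp ?_
    intro hirr
    have h := (X5.O1.irr_two_iff_forall_two_nsmul W).mp hirr
    haveI : Unique {P : W.toAffine.Point // (2 : ℕ) • P = 0} :=
      { default := ⟨0, nsmul_zero 2⟩, uniq := fun P => Subtype.ext (h P.1 P.2) }
    exact h2 Nat.card_unique

end OnePrime

end Summit.BirchSwinnertonDyer.Rank1Residual.P2

end
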